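import Mathlib
import HarnessLib
import Summits.HubbardSuperconductivity.HubbardSuperconductivity.Theorems.KLProgrammeKLRegimeEngineAnisoTorusSumWtFlow
import Summits.HubbardSuperconductivity.HubbardSuperconductivity.Theorems.KLProgrammeH10TwoPointLimitSymbolFrameInstance

/-!
# Route `KLProgramme` — crux K3 ENGINE (stmt-HubbardSuperconductivity-20437) stub (b) conj. 2 «(c-D)² FAMILY TELESCOPE», brick (D5u): the
# REGIME SCALARS of the closed telescope — lattice thresholds, the reference scale `x₀ = 4^{i₀} ≥ 4^{j+4}16^{n_f}`, the weight constant
# `D_w = 1/x₀ + Λ_{n_w}/ρ + Λ_{n_w}/(2σΛx₀)`, and the angular factors at sector depth `m+1`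

Cell `gate-hubbard-kl`, seat hubbard-kl-k3c3-p2 (g11); F1-DESIGN §10.  Pure scalar facts used by `…EngineSliceFamBandTelClosed`:

* `telRegime_lattice` — in the KL regime (`β ≥ β_min`, `β² ≤ L`, `β ≤ M`, `m+1+j ≤ n_β+1`): `Λ_m β < π(2M−5)`, `Λ_{m+j} < π(2M−5)/β`, `π ≤ Λ_m β`,
  `2π·2^{m+1}(2^{m+1}+½) ≤ L`, `γ′π ≤ 2√2·L·Λ_{m+1}` (`γ′ ≤ 4`), `3|2π/L|·(2+½) ≤ 1/10`, `40 ≤ L`, `2 ≤ 2^{m+1}`;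
* `telRegime_refscale` — from `4^{j+4}·16^{m+1} ≤ 4^{i₀}`: `Λ_m = 4^{j+1}Λ`, `Λ_{m+1} = 4^jΛ`, `Λ_{m+1}(2^{m+1})² = e₀`, `W := 4^{j+1}/Λ_m² ≤ 4^{i₀}`,
  `1 ≤ 1/Λ_m²`, `1/Λ_m ≤ 1/Λ_m²`, `1/Λ_m² ≤ W`, `1/Λ ≤ W`, `1 ≤ Λ·4^{i₀}`, `1 ≤ Λ_m²·4^{i₀}`, `1 ≤ Λ_m·4^{i₀}`, `Λ_m ≤ 1`, `Λ ≤ Λ_m`;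
* `telRegime_weights` — `0 ≤ D_w`, `1 ≤ D_w x₀`, `Λ_{n_w}β/(2M) ≤ D_w x₀ s₀` (`s₀ = σΛβ/M`), `Λ_{n_w} ≤ D_w ρ`, `D_w ≤ Λ(1 + 1/ρ + 1/(2σ))`;
* `telRegime_angular` — `(sectorWidth (m+1))⁻¹Λ_m ≤ 2e₀/π`, `1 + 6(sectorWidth (m+1))⁻¹ ≤ 1/Λ_m²`, `sectorWidth (m+1) = π/2^{m+1} ≤ π/2`.

Pure real arithmetic; no definitions, no sorry. [folklore]
-/

noncomputable section

namespace Summit.HubbardSuperconductivity.HubbardSuperconductivity.Theorems.TorusFourierL2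

set_option linter.dupNamespace false -- summit = problem name (single-conjunct summit), D-0017

open Real Literature.MathematicalPhysics.QuantumLattice Literature.Probability.LatticeModels
open Summit.HubbardSuperconductivity.HubbardSuperconductivity.Theorems.KLProgrammeLegKernels
open Summit.HubbardSuperconductivity.HubbardSuperconductivity.Theorems.KLRegimeSplit

/-- **Lattice thresholds of the KL regime at depth `m` and band offset `j`.** [folklore] -/
theorem telRegime_lattice {β : ℝ} (hβmin : klBetaMin ≤ β) {L M : ℕ} (hLβ : β ^ 2 ≤ (L : ℝ)) (hMβ : β ≤ (M : ℝ)) {m j : ℕ}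
    (hm : m + 1 + j ≤ nScales β + 1) {γ' : ℝ} (hγ4 : γ' ≤ 4) :
    klScale klE0 m * β < π * (2 * M - 5) ∧ klScale klE0 (m + j) < π * (2 * M - 5) / β ∧ π ≤ klScale klE0 m * β ∧
      2 * π * (2 : ℝ) ^ (m + 1) * ((2 : ℝ) ^ (m + 1) + 1 / 2) ≤ L ∧ γ' * π ≤ 2 * Real.sqrt 2 * L * klScale klE0 (m + 1) ∧
      3 * |2 * π / (L : ℝ)| * ((2 : ℝ) + 1 / 2) ≤ 1 / 10 ∧ (40 : ℝ) ≤ L ∧ (2 : ℝ) ≤ (2 : ℝ) ^ (m + 1) := by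
  have hβ0 : 0 < β := pos_of_klBetaMin_le hβmin
  have hβ128 : 128 ≤ β := by simpa [klBetaMin] using hβmin
  have hπ := Real.pi_pos
  have hπ3 := Real.pi_gt_three
  have he : (0 : ℝ) < klE0 := by norm_num [klE0]
  have he0 : klE0 = 1 / 32 := rfl
  have hΛe : ∀ k, klScale klE0 k ≤ klE0 := fun k => klScale_le_e0 he.le k
  have hanti : ∀ {a b : ℕ}, a ≤ b → klScale klE0 b ≤ klScale klE0 a := fun hab' => by
    unfold klScale; exact mul_le_mul_of_nonneg_left (inv_anti₀ (by positivity) (pow_le_pow_right₀ (by norm_num) hab')) he.le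
  obtain ⟨-, -, hLz, hL16, hΛβn⟩ := regime_scale_thresholds₃ hβmin hLβ hMβ (show m + 1 ≤ nScales β + 1 by omega)
  have h2M : β / 32 < π * (2 * (M : ℝ) - 5) := by
    have h1 : 3 * (2 * (M : ℝ) - 5) ≤ π * (2 * (M : ℝ) - 5) := mul_le_mul_of_nonneg_right hπ3.le (by linarith only [hMβ, hβ128])
    linarith only [h1, hMβ, hβ128]
  have heβ : klE0 * β = β / 32 := by rw [he0]; ring
  have hN2 : (2 : ℝ) ≤ (2 : ℝ) ^ (m + 1) := by
    calc (2 : ℝ) = 2 ^ 1 := by norm_num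
      _ ≤ 2 ^ (m + 1) := pow_le_pow_right₀ (by norm_num) (by omega)
  refine ⟨?_, ?_, ?_, ?_, ?_, ?_, ?_, hN2⟩
  · have h1 : klScale klE0 m * β ≤ klE0 * β := mul_le_mul_of_nonneg_right (hΛe m) hβ0.le
    linarith only [h1, h2M, heβ]
  · rw [lt_div_iff₀ hβ0]
    have h1 : klScale klE0 (m + j) * β ≤ klE0 * β := mul_le_mul_of_nonneg_right (hΛe (m + j)) hβ0.le
    linarith only [h1, h2M, heβ]
  · have := mul_le_mul_of_nonneg_right ((klth_pi_div_le_klScale_nScales hβmin).trans (hanti (show m ≤ nScales β by omega))) hβ0.le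
    rwa [div_mul_cancel₀ _ hβ0.ne'] at this
  · have h4pow : (2 : ℝ) ^ (m + 1) * ((2 : ℝ) ^ (m + 1) + 1 / 2) ≤ (16 : ℝ) ^ (m + 1) := by
      have h16 : (16 : ℝ) ^ (m + 1) = ((2 : ℝ) ^ (m + 1)) ^ 4 := by
        rw [← pow_mul, show (16 : ℝ) = 2 ^ 4 by norm_num, ← pow_mul]; ring_nf
      rw [h16]
      have hcube : (2 : ℝ) ^ (m + 1) + 1 / 2 ≤ ((2 : ℝ) ^ (m + 1)) ^ 3 := by
        set a : ℝ := (2 : ℝ) ^ (m + 1) with hadef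
        have ha4 : 4 ≤ a ^ 2 := by nlinarith only [hN2]
        have ha3 : 4 * a ≤ a ^ 3 := by nlinarith only [ha4, hN2]
        linarith only [ha3, hN2]
      calc (2 : ℝ) ^ (m + 1) * ((2 : ℝ) ^ (m + 1) + 1 / 2) ≤ (2 : ℝ) ^ (m + 1) * ((2 : ℝ) ^ (m + 1)) ^ 3 := mul_le_mul_of_nonneg_left hcube (by positivity)
        _ = ((2 : ℝ) ^ (m + 1)) ^ 4 := by ring
    have := mul_le_mul_of_nonneg_left h4pow (by positivity : (0 : ℝ) ≤ 2 * π)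
    linarith only [this, hL16]
  · have h1 : π / (4 * β) * β ^ 2 ≤ klScale klE0 (m + 1) * (L : ℝ) := mul_le_mul hΛβn hLβ (by positivity) (klth_klScale_pos _).le
    have e : π / (4 * β) * β ^ 2 = π * β / 4 := by field_simp
    rw [e] at h1
    have h2 : γ' * π ≤ 4 * π := by nlinarith only [hγ4, hπ]
    have h3' : 4 * π ≤ 2 * 1 * (π * β / 4) := by nlinarith only [hβ128, hπ]
    have hs1 : 1 ≤ Real.sqrt 2 := by rw [show (1 : ℝ) = Real.sqrt 1 by simp]; exact Real.sqrt_le_sqrt (by norm_num)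
    calc γ' * π ≤ 2 * 1 * (π * β / 4) := h2.trans h3'
      _ ≤ 2 * Real.sqrt 2 * (klScale klE0 (m + 1) * (L : ℝ)) := by gcongr
      _ = 2 * Real.sqrt 2 * L * klScale klE0 (m + 1) := by ring
  · refine le_trans ?_ hLz
    gcongr
  · exact le_trans (by nlinarith only [hβ128] : (40 : ℝ) ≤ β ^ 2) hLβ

/-- **Reference-scale facts**: `x₀ = 4^{i₀}` dominates `W = 4^{j+1}/Λ_m²` when `4^{j+4}·16^{m+1} ≤ 4^{i₀}`. [folklore] -/
theorem telRegime_refscale {m j i₀ : ℕ} (hwin : (4 : ℝ) ^ (j + 4) * (16 : ℝ) ^ (m + 1) ≤ (4 : ℝ) ^ i₀) :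
    klScale klE0 m = (4 : ℝ) ^ (j + 1) * klScale klE0 (m + 1 + j) ∧ klScale klE0 (m + 1) = (4 : ℝ) ^ j * klScale klE0 (m + 1 + j) ∧
      klScale klE0 (m + 1) * ((2 : ℝ) ^ (m + 1)) ^ 2 = klE0 ∧ (4 : ℝ) ^ (j + 1) * (1 / klScale klE0 m ^ 2) ≤ (4 : ℝ) ^ i₀ ∧
      (1 : ℝ) ≤ 1 / klScale klE0 m ^ 2 ∧ 1 / klScale klE0 m ≤ 1 / klScale klE0 m ^ 2 ∧
      1 / klScale klE0 m ^ 2 ≤ (4 : ℝ) ^ (j + 1) * (1 / klScale klE0 m ^ 2) ∧ 1 / klScale klE0 (m + 1 + j) ≤ (4 : ℝ) ^ (j + 1) * (1 / klScale klE0 m ^ 2) ∧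
      1 ≤ klScale klE0 (m + 1 + j) * (4 : ℝ) ^ i₀ ∧ 1 ≤ klScale klE0 m ^ 2 * (4 : ℝ) ^ i₀ ∧ 1 ≤ klScale klE0 m * (4 : ℝ) ^ i₀ ∧
      klScale klE0 m ≤ 1 ∧ klScale klE0 (m + 1 + j) ≤ klScale klE0 m := by
  have he : (0 : ℝ) < klE0 := by norm_num [klE0]
  have he0 : klE0 = 1 / 32 := rfl
  set Λs : ℝ := klScale klE0 (m + 1 + j) with hΛsdef
  set lam : ℝ := klScale klE0 m with hlamdef
  have hΛs : 0 < Λs := klth_klScale_pos _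
  have hlam0 : 0 < lam := klth_klScale_pos _
  have hlam1 : lam ≤ 1 := (klScale_le_e0 he.le m).trans (by norm_num [klE0])
  have hanti : ∀ {a b : ℕ}, a ≤ b → klScale klE0 b ≤ klScale klE0 a := fun hab' => by
    unfold klScale; exact mul_le_mul_of_nonneg_left (inv_anti₀ (by positivity) (pow_le_pow_right₀ (by norm_num) hab')) he.le
  have hlamΛ : lam = (4 : ℝ) ^ (j + 1) * Λs := by rw [hlamdef, hΛsdef, klScale, klScale, pow_add, pow_add]; field_simp; ring
  have hΛ₁ : klScale klE0 (m + 1) = (4 : ℝ) ^ j * Λs := by rw [hΛsdef, klScale, klScale, pow_add, pow_add]; field_simp; ring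
  have hNΛ : klScale klE0 (m + 1) * ((2 : ℝ) ^ (m + 1)) ^ 2 = klE0 := by
    rw [klScale, ← pow_mul, show (2 : ℝ) ^ ((m + 1) * 2) = (4 : ℝ) ^ (m + 1) by rw [pow_mul']; norm_num]; field_simp
  have hx₀1 : (1 : ℝ) ≤ (4 : ℝ) ^ i₀ := one_le_pow₀ (by norm_num)
  have hx₀0 : (0 : ℝ) < (4 : ℝ) ^ i₀ := by positivity
  have hWeq : (4 : ℝ) ^ (j + 1) * (1 / lam ^ 2) = (4 : ℝ) ^ (j + 4) * (16 : ℝ) ^ (m + 1) := by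
    rw [hlamdef, klScale, he0, show (16 : ℝ) ^ (m + 1) = ((4 : ℝ) ^ (m + 1)) ^ 2 by
      rw [← pow_mul, show (16 : ℝ) = 4 ^ 2 by norm_num, ← pow_mul]; ring_nf, pow_add, pow_add (4 : ℝ) j 4, pow_add (4 : ℝ) m 1]
    field_simp; ring
  have hx₀W : (4 : ℝ) ^ (j + 1) * (1 / lam ^ 2) ≤ (4 : ℝ) ^ i₀ := by rw [hWeq]; exact hwin
  have hY1 : (1 : ℝ) ≤ 1 / lam ^ 2 := by rw [le_div_iff₀ (by positivity), one_mul]; exact pow_le_one₀ hlam0.le hlam1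
  have hY : 1 / lam ≤ 1 / lam ^ 2 := one_div_le_one_div_of_le (by positivity) (by nlinarith only [hlam1, hlam0])
  have hYW : 1 / lam ^ 2 ≤ (4 : ℝ) ^ (j + 1) * (1 / lam ^ 2) := le_mul_of_one_le_left (by positivity) (one_le_pow₀ (by norm_num))
  have hΛW : 1 / Λs ≤ (4 : ℝ) ^ (j + 1) * (1 / lam ^ 2) := by
    have e : 1 / Λs = (4 : ℝ) ^ (j + 1) * (1 / lam) := by rw [hlamΛ]; field_simp
    rw [e]; exact mul_le_mul_of_nonneg_left hY (by positivity)
  have hΛx : 1 ≤ Λs * (4 : ℝ) ^ i₀ := by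
    have h := hΛW.trans hx₀W; rw [div_le_iff₀ hΛs] at h; linarith
  have hlx2 : 1 ≤ lam ^ 2 * (4 : ℝ) ^ i₀ := by
    have h := hYW.trans hx₀W; rw [div_le_iff₀ (by positivity)] at h; linarith
  have hlx : 1 ≤ lam * (4 : ℝ) ^ i₀ := hlx2.trans (mul_le_mul_of_nonneg_right (by nlinarith only [hlam1, hlam0]) hx₀0.le)
  exact ⟨hlamΛ, hΛ₁, hNΛ, hx₀W, hY1, hY, hYW, hΛW, hΛx, hlx2, hlx, hlam1, hanti (by omega)⟩

/-- **Weight-constant facts** for `D_w = 1/x₀ + Λ_{n_w}/ρ + Λ_{n_w}/(2σΛx₀)`. [folklore] -/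
theorem telRegime_weights {Λs Λnw ρ σ x₀ β M : ℝ} (hΛs : 0 < Λs) (hΛnw0 : 0 ≤ Λnw) (hΛnw : Λnw ≤ Λs) (hρ : 0 < ρ) (hσ : 0 < σ) (hx₀ : 0 < x₀)
    (hΛx : 1 ≤ Λs * x₀) (hβ : 0 < β) (hM : 0 < M) :
    0 ≤ 1 / x₀ + Λnw / ρ + Λnw / (2 * σ * Λs * x₀) ∧ 1 ≤ (1 / x₀ + Λnw / ρ + Λnw / (2 * σ * Λs * x₀)) * x₀ ∧
      Λnw * β / (2 * M) ≤ (1 / x₀ + Λnw / ρ + Λnw / (2 * σ * Λs * x₀)) * x₀ * (σ * Λs * β / M) ∧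
      Λnw ≤ (1 / x₀ + Λnw / ρ + Λnw / (2 * σ * Λs * x₀)) * ρ ∧ 1 / x₀ + Λnw / ρ + Λnw / (2 * σ * Λs * x₀) ≤ Λs * (1 + 1 / ρ + 1 / (2 * σ)) := by
  refine ⟨by positivity, ?_, ?_, ?_, ?_⟩
  · have e : (1 / x₀ + Λnw / ρ + Λnw / (2 * σ * Λs * x₀)) * x₀ = 1 + (Λnw / ρ * x₀ + Λnw / (2 * σ * Λs)) := by field_simp; ring
    rw [e]; exact le_add_of_nonneg_right (by positivity)
  · have e : (1 / x₀ + Λnw / ρ + Λnw / (2 * σ * Λs * x₀)) * x₀ * (σ * Λs * β / M) = Λnw * β / (2 * M) + (1 / x₀ + Λnw / ρ) * x₀ * (σ * Λs * β / M) := by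
      field_simp; ring
    rw [e]; exact le_add_of_nonneg_right (by positivity)
  · have e : (1 / x₀ + Λnw / ρ + Λnw / (2 * σ * Λs * x₀)) * ρ = Λnw + (1 / x₀ + Λnw / (2 * σ * Λs * x₀)) * ρ := by field_simp; ring
    rw [e]; exact le_add_of_nonneg_right (by positivity)
  · have h1 : 1 / x₀ ≤ Λs := by rw [div_le_iff₀ hx₀]; linarith [hΛx]
    have h2 : Λnw / ρ ≤ Λs / ρ := div_le_div_of_nonneg_right hΛnw hρ.le
    have h3 : Λnw / (2 * σ * Λs * x₀) ≤ Λs / (2 * σ) := by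
      rw [div_le_div_iff₀ (by positivity) (by positivity)]
      calc Λnw * (2 * σ) ≤ Λs * 1 * (2 * σ) := by rw [mul_one]; exact mul_le_mul_of_nonneg_right hΛnw (by positivity)
        _ ≤ Λs * (Λs * x₀) * (2 * σ) := by gcongr
        _ = Λs * (2 * σ * Λs * x₀) := by ring
    have e : Λs * (1 + 1 / ρ + 1 / (2 * σ)) = Λs + Λs / ρ + Λs / (2 * σ) := by ring
    rw [e]; linarith

/-- **Angular factors at sector depth `m+1`**: `(sectorWidth (m+1))⁻¹Λ_m ≤ 2e₀/π`, `1 + 6(sectorWidth (m+1))⁻¹ ≤ 1/Λ_m²`,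
`sectorWidth (m+1) = π/2^{m+1} ≤ π/2`. [folklore] -/
theorem telRegime_angular (m : ℕ) :
    (sectorWidth (m + 1))⁻¹ * klScale klE0 m ≤ 2 * klE0 / π ∧ 1 + 6 * (sectorWidth (m + 1))⁻¹ ≤ 1 * (1 / klScale klE0 m ^ 2) ∧
      sectorWidth (m + 1) = π / (2 : ℝ) ^ (m + 1) ∧ sectorWidth (m + 1) ≤ π / 2 := by
  have hπ := Real.pi_pos
  have hπ3 := Real.pi_gt_three
  have he0 : klE0 = 1 / 32 := rfl
  have hw : sectorWidth (m + 1) = π / (2 : ℝ) ^ (m + 1) := rfl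
  have hN2 : (2 : ℝ) ≤ (2 : ℝ) ^ (m + 1) := by
    calc (2 : ℝ) = 2 ^ 1 := by norm_num
      _ ≤ 2 ^ (m + 1) := pow_le_pow_right₀ (by norm_num) (by omega)
  have h24 : (2 : ℝ) ^ (m + 1) ≤ 2 * (4 : ℝ) ^ m := by
    rw [pow_succ]; nlinarith only [pow_le_pow_left₀ (by norm_num : (0:ℝ) ≤ 2) (by norm_num : (2:ℝ) ≤ 4) m]
  have h4 : (1 : ℝ) ≤ (4 : ℝ) ^ m := one_le_pow₀ (by norm_num)
  refine ⟨?_, ?_, hw, ?_⟩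
  · rw [hw, klScale, inv_div]
    have e : (2 : ℝ) ^ (m + 1) / π * (klE0 * ((4 : ℝ) ^ m)⁻¹) = ((2 : ℝ) ^ (m + 1) / (4 : ℝ) ^ m) * (klE0 / π) := by field_simp
    rw [e, show 2 * klE0 / π = 2 * (klE0 / π) by ring]
    exact mul_le_mul_of_nonneg_right (by rw [div_le_iff₀ (by positivity)]; exact h24) (by rw [he0]; positivity)
  · rw [hw, inv_div, klScale, he0, one_mul]
    have e : 1 / (1 / 32 * ((4 : ℝ) ^ m)⁻¹) ^ 2 = 1024 * ((4 : ℝ) ^ m) ^ 2 := by field_simp; ring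
    rw [e]
    have h6 : 6 * ((2 : ℝ) ^ (m + 1) / π) ≤ 4 * (4 : ℝ) ^ m := by
      rw [mul_div_assoc', div_le_iff₀ hπ]; nlinarith only [h24, hπ3, h4]
    nlinarith only [h6, h4]
  · rw [hw]; exact div_le_div_of_nonneg_left hπ.le (by norm_num) hN2

end Summit.HubbardSuperconductivity.HubbardSuperconductivity.Theorems.TorusFourierL2

end
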